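import Literature.AlgebraicGeometry.HodgeTheory.CMHodgeGroupCentreWeil
import HarnessLib

/-!
# The centre of `Lie Hg` for a CM field, III: the `K`-WEIL members — «centre ⊇ 𝔷₀ = Lie(U_E ∩ SU_K)-centre»
# (Moonen–Zarhin 1998 §4 Remark (1) and Criterion (crit2); Moonen–Zarhin 1999 §2 (2.3); Ribet 1983 Thm. 0)

Family `hodge`, layer `Literature/AlgebraicGeometry/HodgeTheory` (cell `pub-hodgeav-hg6`, req-37 (A) Q2b, TABLE X ROW 13
`g6.IV(3,1).kE0` = the sextic-CM pattern `(2,2,1)` members OF WEIL TYPE for an imaginary quadratic `K ⊂ E`; eng-3 g3, job B6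
row 13; continues eng-5 g6's `CMHodgeGroupCentre` ∕ `CMHodgeGroupCentreWeil`). UNCONDITIONAL; theorems only, no definition,
no named fact, no `sorry`. HONEST FRAMING of that cell: HC ∕ HC_AV ∕ HC_CM ∕ H2 NOT proved — linear algebra of polarized
weight-one `ℚ`-Hodge structures.

SETTING (as in `CMThetaCentre.centre_or_exists_skew`): `H` effective polarized of weight `1`, `E = End_Hdg(V) = ℚ[φ]` of
dimension `2|ι|` with every non-zero element invertible, a CM type `μ : ι → ℂ` with blocks `W_{μ k}` of rank `n₀`, an
admissible `𝔤 ∋ Θ_ℂ` with LIFT; `|ι| ≤ 3` with places `k₀` (BALANCED), `k₁ ≠ k₂` of weights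
`t_k = dim W_{μ k}^{1,0} − dim W_{μ k}^{0,1}` with `t_{k₁} + t_{k₂} = 0 ≠ t_{k₂}` — the `K`-Weil signature along `μ` — and THE
`K`-DATUM: a `ψ`-skew `φ_K ∈ E` acting by ONE scalar `μ_K ≠ 0` on every `W_{μ k}` (`μ` is the `K`-fibre of the CM types).
For these members `Hg ⊆ U_E ∩ SU_K` has a centre of dimension `|ι| − 1`, and eng-5 g6's `hnoWeil` FAILS (`y = φ_K` is a
Weil-type quadratic element); this file proves the replacement.
* §1 **`CMThetaCentre.scalars_const_of_traceOrthogonal_kWeil`** — a non-zero `ψ`-skew `y ∈ E` with `Σ_k σ_k(y) t_k = 0`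
  (e.g. trace-orthogonal to `𝔤 ∋ Θ`) acts by the SAME scalar on all `W_{μ k}`: `σ_{k₁} = σ_{k₂}` from the weights;
  `σ_{k₀} = ±σ_{k₁}` by `CMArith.false_of_two_eigenvalues` on `y²` (multiplicities `4n₀ ≠ 2n₀`); the sign `−` dies by the
  same lemma applied to `φ_K y` (which acts by `μ_K σ_k(y)` on BOTH `W_{μ k}` and its conjugate block).
* §2 **`CMThetaCentre.centre_of_pair_kWeil`** — CENTRE ⊇ 𝔷₀: for every `c : ι → ℂ` with `Σ_k c_k = 0` some `C ∈ 𝔤_ℂ` acts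
  by `c_k` on `W_{μ k}`. PROOF inside eng-5's frame (adapted dual basis `cb`, coordinate traces `trv_k`, rational trace vectors
  `rL(X) = (Tr(y_i X))_i` for a `ℚ`-basis `(y_i)` of `E⁻`): if `rL(𝔤) = ℚ^{|ι|}` the full centre lies in `𝔤_ℂ` (verbatim);
  otherwise a trace-orthogonal `y ≠ 0` exists, is constant by §1, so `Σ_k trv_k(𝔤_ℂ) = 0`; and some `D ∈ 𝔤_ℂ` has
  `trv_{k₀}(D) ≠ 0` — else every `rL(X)` is a complex multiple of the fixed vector `(σ_{k₁}(y_i) − σ_{k₂}(y_i))_i`, `rL(𝔤)` is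
  `ℚ`-one-dimensional, two independent rational functionals kill it, and the two resulting trace-orthogonal elements of `E⁻`
  are both constant (§1), hence `ℚ`-dependent (`CMArith.linearIndependent_baseChange`) — contradiction; `Θ` (coordinate
  traces `t`) and `D` then produce every `n₀ (e_{k₀} − e_k)` as a coordinate-trace vector, and LIFT makes them central.
(«The centre `Z(Hdg) ⊂ U_E` acts on `W_K` through `det_K`; `W_K` consists of Hodge classes iff the `K`-signature is
`(g/2, g/2)`», Moonen–Zarhin 1998; the row-13 members have `Hg = U_E ∩ SU_K` with centre `{z ∈ E⁻ : Tr_{E₀}(z/φ_K) = 0}`.)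

## References
* [MoonenZarhin1998WeilClasses] B. Moonen, Yu. Zarhin, Weil classes on abelian varieties, J. reine angew. Math. 496 (1998),
  Criterion (crit1) p. 1, §4 Remark (1) and (2) [corpus: paper-arxiv-alg-geom_9612017 p0001 L93–97, p0004 L53–85].
* [MoonenZarhin1999LowDim] B. Moonen, Yu. Zarhin, Math. Ann. 315 (1999), §1 (1.8), §2 (2.3).
* [Ribet1983] K. A. Ribet, Amer. J. Math. 105 (1983), Thm. 0, §3.
* [Deligne1982HodgeCycles] P. Deligne, LNM 900 (1982), I §3 Prop. 3.4, §4 (p. 30).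
-/

noncomputable section

open scoped TensorProduct
open Module

namespace Literature.AlgebraicGeometry.Motives

namespace HodgeStructure

universe u

variable {V : Type u} [AddCommGroup V] [Module ℚ V] {n : ℤ}

/-! ### §1 A non-zero skew `y ∈ E` orthogonal to the Hodge weights is `K`-proportional -/

/-- **A `ψ`-SKEW `y ∈ E` WITH `Σ_k σ_k(y) t_k = 0` ACTS BY ONE SCALAR ON ALL `W_{μ k}`** for the `K`-Weil pattern (places
`k₀` balanced, `k₁ ≠ k₂` with `t_{k₁} + t_{k₂} = 0 ≠ t_{k₂}`, `|ι| ≤ 3`, a skew `φ_K ∈ E` acting by one scalar `μ_K ≠ 0` on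
every `W_{μ k}`): `σ_k(y) = σ_{k₁}(y)` for all `k`. [cite: MoonenZarhin1998WeilClasses, §4 Remark (2)]
[cite: MoonenZarhin1999LowDim, §2 (2.3)] [cite: Ribet1983, Thm. 0] -/
theorem CMThetaCentre.scalars_const_of_traceOrthogonal_kWeil [Module.Finite ℚ V] [HodgeTensorFacts.{u, u}] {ι : Type}
    [Fintype ι] [DecidableEq ι] (hι : Fintype.card ι ≤ 3)
    (H : HodgeStructure V n) (hn : n = 1) (heff : H.IsEffective) (ψ : H.Polarization)
    {φ : Module.End ℚ V} (hφE : φ ∈ H.endAlg) {m : ℕ} (hE : ∀ a ∈ H.endAlg, ∃ q : Fin m → ℚ, a = ∑ k, q k • φ ^ (k : ℕ))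
    (hdiv : ∀ a ∈ H.endAlg, a ≠ 0 → ∃ b : Module.End ℚ V, b * a = 1)
    (μ : ι → ℂ) (hinj : Function.Injective μ) (hdist : ∀ k k', μ k' ≠ starRingEnd ℂ (μ k)) {n₀ : ℕ} (hn₀ : n₀ ≠ 0)
    (hrank : ∀ k, Module.finrank ℂ ↥(Module.End.eigenspace (φ.baseChange ℂ) (μ k) ⊓ H.piece 1 0) +
      Module.finrank ℂ ↥(Module.End.eigenspace (φ.baseChange ℂ) (μ k) ⊓ H.piece 0 1) = n₀)
    (htop : (⨆ kt : ι × Fin 2, Module.End.eigenspace (φ.baseChange ℂ)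
      (if kt.2 = 0 then μ kt.1 else starRingEnd ℂ (μ kt.1))) = ⊤)
    (k₀ k₁ k₂ : ι) (hk₁₂ : k₁ ≠ k₂) (hk₁ : k₁ ≠ k₀) (hk₂ : k₂ ≠ k₀)
    (hk₀bal : Module.finrank ℂ ↥(Module.End.eigenspace (φ.baseChange ℂ) (μ k₀) ⊓ H.piece 1 0) =
      Module.finrank ℂ ↥(Module.End.eigenspace (φ.baseChange ℂ) (μ k₀) ⊓ H.piece 0 1))
    (ht : ((Module.finrank ℂ ↥(Module.End.eigenspace (φ.baseChange ℂ) (μ k₁) ⊓ H.piece 1 0) : ℤ) -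
        Module.finrank ℂ ↥(Module.End.eigenspace (φ.baseChange ℂ) (μ k₁) ⊓ H.piece 0 1)) +
      ((Module.finrank ℂ ↥(Module.End.eigenspace (φ.baseChange ℂ) (μ k₂) ⊓ H.piece 1 0) : ℤ) -
        Module.finrank ℂ ↥(Module.End.eigenspace (φ.baseChange ℂ) (μ k₂) ⊓ H.piece 0 1)) = 0)
    (ht0 : Module.finrank ℂ ↥(Module.End.eigenspace (φ.baseChange ℂ) (μ k₂) ⊓ H.piece 1 0) ≠
      Module.finrank ℂ ↥(Module.End.eigenspace (φ.baseChange ℂ) (μ k₂) ⊓ H.piece 0 1))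
    {φK : Module.End ℚ V} (hφKE : φK ∈ H.endAlg) (hφKskew : ∀ v w, ψ.form (φK v) w + ψ.form v (φK w) = 0)
    {μK : ℂ} (hμK : μK ≠ 0)
    (hKE : ∀ k, ∀ w ∈ Module.End.eigenspace (φ.baseChange ℂ) (μ k), φK.baseChange ℂ w = μK • w)
    {y : Module.End ℚ V} (hyE : y ∈ H.endAlg) (hy0 : y ≠ 0) (hyskew : ∀ v w, ψ.form (y v) w + ψ.form v (y w) = 0)
    (σ : ι → ℂ) (hσ : ∀ k, ∀ w ∈ Module.End.eigenspace (φ.baseChange ℂ) (μ k), y.baseChange ℂ w = σ k • w)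
    (hsum : ∑ k, σ k * (((Module.finrank ℂ ↥(Module.End.eigenspace (φ.baseChange ℂ) (μ k) ⊓ H.piece 1 0) : ℂ) -
      (Module.finrank ℂ ↥(Module.End.eigenspace (φ.baseChange ℂ) (μ k) ⊓ H.piece 0 1) : ℂ))) = 0) :
    ∀ k, σ k = σ k₁ := by
  classical
  haveI : Module.Free ℚ V := Module.Free.of_divisionRing ℚ V
  set F := φ.baseChange ℂ with hF
  -- every place is one of `k₁, k₂, k₀`; `|ι| = 3`
  have huniv : ∀ i, i = k₁ ∨ i = k₂ ∨ i = k₀ := by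
    have h3 : ({k₁, k₂, k₀} : Finset ι) = Finset.univ := by
      apply Finset.eq_of_subset_of_card_le (Finset.subset_univ _)
      rw [Finset.card_univ, Finset.card_insert_of_notMem (by simp [hk₁₂, hk₁]),
        Finset.card_insert_of_notMem (by simp [hk₂]), Finset.card_singleton]
      exact hι
    intro i
    have hi : i ∈ ({k₁, k₂, k₀} : Finset ι) := by rw [h3]; exact Finset.mem_univ _
    simpa using hi
  have hcard3 : Fintype.card ι = 3 := by
    apply le_antisymm hι
    have h := Finset.card_le_univ ({k₁, k₂, k₀} : Finset ι)
    rwa [Finset.card_insert_of_notMem (by simp [hk₁₂, hk₁]), Finset.card_insert_of_notMem (by simp [hk₂]),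
      Finset.card_singleton] at h
  -- the weights
  set t : ι → ℂ := fun k => ((Module.finrank ℂ ↥(Module.End.eigenspace F (μ k) ⊓ H.piece 1 0) : ℂ) -
    (Module.finrank ℂ ↥(Module.End.eigenspace F (μ k) ⊓ H.piece 0 1) : ℂ)) with htdef
  have hsum' : ∑ k, σ k * t k = 0 := hsum
  have ht' : t k₁ + t k₂ = 0 := by
    have h := congrArg (fun z : ℤ => (z : ℂ)) ht
    simpa [htdef] using h
  have ht0' : t k₂ ≠ 0 := by
    simp only [htdef, sub_ne_zero, Ne, Nat.cast_inj]; exact ht0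
  have htk₀ : t k₀ = 0 := by simp only [htdef, hk₀bal, sub_self]
  -- `σ k₁ = σ k₂`
  have hrel : σ k₁ * t k₁ + σ k₂ * t k₂ = 0 := by
    rw [← hsum', Finset.sum_eq_add k₁ k₂ hk₁₂ (fun k _ hk' => by
        rcases huniv k with e | e | e
        · exact absurd e hk'.1
        · exact absurd e hk'.2
        · rw [e, htk₀, mul_zero])
      (fun h => absurd (Finset.mem_univ k₁) h) (fun h => absurd (Finset.mem_univ k₂) h)]
  have h12 : σ k₁ = σ k₂ := by
    have h2 : (σ k₂ - σ k₁) * t k₂ = 0 := by linear_combination hrel - σ k₁ * ht'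
    exact (sub_eq_zero.1 ((mul_eq_zero.1 h2).resolve_right ht0')).symm
  -- `y ≠ 0` acts by non-zero scalars
  have hW : ∀ k, Module.End.eigenspace F (μ k) ≠ ⊥ := by
    intro k h
    have hfin : Module.finrank ℂ ↥(Module.End.eigenspace F (μ k)) = n₀ := by
      rw [hF, CMTheta.finrank_eigenspace_eq_add H hn heff hφE, hrank k]
    rw [h, finrank_bot] at hfin
    exact hn₀ hfin.symm
  have hσ0 : ∀ k, σ k ≠ 0 := by
    intro k hk
    obtain ⟨w, hw, hw0⟩ := (Submodule.ne_bot_iff _).1 (hW k)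
    exact CMArith.apply_ne_zero H hdiv hyE hy0 hw0 (by rw [hσ k w hw, hk, zero_smul])
  -- `E` is commutative; `y_ℂ`, `φ_{K,ℂ}` commute with `φ_ℂ`
  have hEcomm : ∀ a ∈ H.endAlg, ∀ b ∈ H.endAlg, a * b = b * a := fun a ha b hb =>
    CMThetaCentre.mul_comm_of_hE H hE ha hb
  have hyφ : y.baseChange ℂ * F = F * y.baseChange ℂ := by
    rw [hF, ← LinearMap.baseChange_mul, hEcomm y hyE φ hφE, LinearMap.baseChange_mul]
  have hKφ : φK.baseChange ℂ * F = F * φK.baseChange ℂ := by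
    rw [hF, ← LinearMap.baseChange_mul, hEcomm φK hφKE φ hφE, LinearMap.baseChange_mul]
  have hyskewC := CMThetaCentre.baseChange_skew H ψ hyskew
  have hKskewC := CMThetaCentre.baseChange_skew H ψ hφKskew
  -- the adapted dual basis; `y_ℂ` is `σ k` on the `(k,0)`- and `−σ k` on the `(k,1)`-vectors, `φ_{K,ℂ}` is `±μ_K`
  obtain ⟨cb, κ, hcbW, hcbW', -, -, hdual, hiso⟩ :=
    CMTheta.exists_adaptedDualBasis H hn heff ψ hφE hE μ hinj hdist hrank htop
  have hfin : ∀ k, Module.finrank ℂ ↥(Module.End.eigenspace F (μ k)) = n₀ := fun k => by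
    rw [hF, CMTheta.finrank_eigenspace_eq_add H hn heff hφE, hrank k]
  have hfin' : ∀ k, Module.finrank ℂ ↥(Module.End.eigenspace F (starRingEnd ℂ (μ k))) = n₀ := fun k => by
    rw [← hfin k, hF, ← finrank_eigenspace_baseChange_conj_eq starRingAut φ (μ k), starRingAut_apply,
      starRingEnd_apply]
  have he1 : ∀ k : ι, Function.Injective (fun j : Fin n₀ => (((k, (1 : Fin 2)), j) : (ι × Fin 2) × Fin n₀)) :=
    fun k j j' h => by simpa using h
  have hW'span : ∀ k, Module.End.eigenspace F (starRingEnd ℂ (μ k)) =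
      Submodule.span ℂ (Set.range (cb ∘ fun j : Fin n₀ => ((k, (1 : Fin 2)), j))) :=
    fun k => CMArith.eq_span_of_basis cb _ (he1 k) _ (hcbW' k) (hfin' k)
  have hy0v : ∀ k j, y.baseChange ℂ (cb ((k, 0), j)) = σ k • cb ((k, 0), j) := fun k j => hσ k _ (hcbW k j)
  have hy1v : ∀ k j, y.baseChange ℂ (cb ((k, 1), j)) = -(σ k • cb ((k, 1), j)) :=
    CMArith.apply_eq_neg_smul_of_skew cb (ψ.form.baseChange ℂ) hdual hiso _ σ hy0v hyskewC (fun k j => by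
      rw [← hW'span k]
      exact UnitaryTheta.apply_mem_eigenspace_of_commute hyφ (hcbW' k j))
  have hK0v : ∀ k j, φK.baseChange ℂ (cb ((k, 0), j)) = (fun _ : ι => μK) k • cb ((k, 0), j) := fun k j =>
    hKE k _ (hcbW k j)
  have hK1v : ∀ k j, φK.baseChange ℂ (cb ((k, 1), j)) = -((fun _ : ι => μK) k • cb ((k, 1), j)) :=
    CMArith.apply_eq_neg_smul_of_skew cb (ψ.form.baseChange ℂ) hdual hiso _ (fun _ : ι => μK) hK0v hKskewC
      (fun k j => by
        rw [← hW'span k]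
        exact UnitaryTheta.apply_mem_eigenspace_of_commute hKφ (hcbW' k j))
  -- counting: the vectors over the place `k₀` are `2n₀` out of `6n₀`
  have hcount : ∀ (s : (ι × Fin 2) × Fin n₀ → ℂ) (a c : ℂ), a ≠ c → (∀ i, s i = c ↔ i.1.1 = k₀) →
      (∀ i, s i = a ∨ s i = c) →
      (Finset.univ.filter fun i => s i = a).card ≠ (Finset.univ.filter fun i => s i = c).card := by
    intro s a c hac hiff hval
    have hcountc : (Finset.univ.filter fun i : (ι × Fin 2) × Fin n₀ => s i = c).card = 2 * n₀ := by
      have hset : (Finset.univ.filter fun i : (ι × Fin 2) × Fin n₀ => s i = c) =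
          (({k₀} : Finset ι) ×ˢ (Finset.univ : Finset (Fin 2))) ×ˢ (Finset.univ : Finset (Fin n₀)) := by
        ext ⟨⟨k', r⟩, j⟩
        simp only [Finset.mem_filter, Finset.mem_univ, true_and, Finset.mem_product, Finset.mem_singleton, and_true]
        exact hiff ((k', r), j)
      rw [hset, Finset.card_product, Finset.card_product, Finset.card_singleton, Finset.card_univ, Finset.card_univ,
        Fintype.card_fin, Fintype.card_fin, one_mul]
    have htot : (Finset.univ.filter fun i : (ι × Fin 2) × Fin n₀ => s i = a).card +
        (Finset.univ.filter fun i : (ι × Fin 2) × Fin n₀ => s i = c).card = Fintype.card ι * 2 * n₀ := by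
      have hneg : (Finset.univ.filter fun i : (ι × Fin 2) × Fin n₀ => s i = c) =
          Finset.univ.filter fun i : (ι × Fin 2) × Fin n₀ => ¬ s i = a := by
        ext i
        simp only [Finset.mem_filter, Finset.mem_univ, true_and]
        constructor
        · intro h h'; exact hac (h'.symm.trans h)
        · intro h
          rcases hval i with e | e
          · exact absurd e h
          · exact e
      rw [hneg, Finset.card_filter_add_card_filter_not, Finset.card_univ, Fintype.card_prod,
        Fintype.card_prod, Fintype.card_fin, Fintype.card_fin]
    intro hc
    rw [hc, hcountc, hcard3] at htot
    omega
  have hn₀pos : 0 < n₀ := Nat.pos_of_ne_zero hn₀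
  -- (A3) `σ k₀ ² = σ k₁ ²`: otherwise `y²` has two values of multiplicities `4n₀ ≠ 2n₀`
  have huE : y * y ∈ H.endAlg := H.endAlg.mul_mem hyE hyE
  set s : (ι × Fin 2) × Fin n₀ → ℂ := fun i => σ i.1.1 ^ 2 with hsdef
  have hu : ∀ i, (y * y).baseChange ℂ (cb i) = s i • cb i := by
    rintro ⟨⟨k, r⟩, j⟩
    rw [LinearMap.baseChange_mul, Module.End.mul_apply]
    rcases Fin.exists_fin_two.1 ⟨r, rfl⟩ with h | h <;> rw [h]
    · rw [hy0v, map_smul, hy0v, smul_smul]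
      simp only [hsdef, sq]
    · rw [hy1v, map_neg, map_smul, hy1v, smul_neg, neg_neg, smul_smul]
      simp only [hsdef, sq]
  have hsq : σ k₀ ^ 2 = σ k₁ ^ 2 := by
    by_contra hne
    have hval : ∀ k', σ k' ^ 2 = σ k₁ ^ 2 ∨ σ k' ^ 2 = σ k₀ ^ 2 := fun k' => by
      rcases huniv k' with rfl | rfl | rfl
      · exact Or.inl rfl
      · exact Or.inl (by rw [h12])
      · exact Or.inr rfl
    have hiff : ∀ i : (ι × Fin 2) × Fin n₀, s i = σ k₀ ^ 2 ↔ i.1.1 = k₀ := fun i => by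
      constructor
      · intro h
        by_contra hne'
        rcases huniv i.1.1 with e | e | e
        · exact hne (by rw [hsdef] at h; simp only at h; rw [e] at h; exact h.symm)
        · exact hne (by rw [hsdef] at h; simp only at h; rw [e, ← h12] at h; exact h.symm)
        · exact hne' e
      · intro h; rw [hsdef]; simp only; rw [h]
    exact CMArith.false_of_two_eigenvalues H hdiv huE cb s hu (a := σ k₁ ^ 2) (c := σ k₀ ^ 2) (Ne.symm hne)
      (fun i => hval i.1.1) (hcount s _ _ (Ne.symm hne) hiff (fun i => hval i.1.1))
      ⟨((k₁, 0), ⟨0, hn₀pos⟩), rfl⟩ ⟨((k₀, 0), ⟨0, hn₀pos⟩), by rw [hsdef]⟩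
  -- (A4) `σ k₀ = σ k₁`: the sign `−` would make `φ_K y` two-valued with multiplicities `4n₀ ≠ 2n₀`
  have hk₀eq : σ k₀ = σ k₁ := by
    rcases sq_eq_sq_iff_eq_or_eq_neg.1 hsq with h | h
    · exact h
    exfalso
    have hvE : φK * y ∈ H.endAlg := H.endAlg.mul_mem hφKE hyE
    set s' : (ι × Fin 2) × Fin n₀ → ℂ := fun i => μK * σ i.1.1 with hs'def
    have hv : ∀ i, (φK * y).baseChange ℂ (cb i) = s' i • cb i := by
      rintro ⟨⟨k, r⟩, j⟩
      rw [LinearMap.baseChange_mul, Module.End.mul_apply]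
      rcases Fin.exists_fin_two.1 ⟨r, rfl⟩ with h' | h' <;> rw [h']
      · rw [hy0v, map_smul, hK0v, smul_smul]
        simp only [hs'def, mul_comm (σ k) μK]
      · rw [hy1v, map_neg, map_smul, hK1v, smul_neg, neg_neg, smul_smul]
        simp only [hs'def, mul_comm (σ k) μK]
    have hac : μK * σ k₁ ≠ μK * σ k₀ := by
      intro e
      have e' : σ k₁ = σ k₀ := mul_left_cancel₀ hμK e
      rw [h] at e'
      exact hσ0 k₁ (by linear_combination e' / 2)
    have hval : ∀ k', μK * σ k' = μK * σ k₁ ∨ μK * σ k' = μK * σ k₀ := fun k' => by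
      rcases huniv k' with rfl | rfl | rfl
      · exact Or.inl rfl
      · exact Or.inl (by rw [h12])
      · exact Or.inr rfl
    have hiff : ∀ i : (ι × Fin 2) × Fin n₀, s' i = μK * σ k₀ ↔ i.1.1 = k₀ := fun i => by
      constructor
      · intro h'
        by_contra hne'
        rcases huniv i.1.1 with e | e | e
        · exact hac (by rw [hs'def] at h'; simp only at h'; rw [e] at h'; exact h')
        · exact hac (by rw [hs'def] at h'; simp only at h'; rw [e, ← h12] at h'; exact h')
        · exact hne' e
      · intro h'; rw [hs'def]; simp only; rw [h']
    exact CMArith.false_of_two_eigenvalues H hdiv hvE cb s' hv (a := μK * σ k₁) (c := μK * σ k₀) hac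
      (fun i => hval i.1.1) (hcount s' _ _ hac hiff (fun i => hval i.1.1))
      ⟨((k₁, 0), ⟨0, hn₀pos⟩), rfl⟩ ⟨((k₀, 0), ⟨0, hn₀pos⟩), by rw [hs'def]⟩
  intro k
  rcases huniv k with rfl | rfl | rfl
  · rfl
  · exact h12.symm
  · exact hk₀eq

/-! ### §2 CENTRE ⊇ 𝔷₀ for the `K`-Weil members -/

/-- **CENTRE ⊇ 𝔷₀ FOR THE `K`-WEIL PATTERN** (see the module docstring): `|ι| ≤ 3`, places `k₀` balanced, `k₁ ≠ k₂` with
`t_{k₁} + t_{k₂} = 0 ≠ t_{k₂}`, a `ψ`-skew `φ_K ∈ E` acting by one scalar `μ_K ≠ 0` on every `W_{μ k}`, and LIFT. Then for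
every `c : ι → ℂ` with `Σ_k c_k = 0` some `C ∈ 𝔤_ℂ` acts by `c_k` on `W_{μ k}` (all `k`) — the Lie algebra of the centre of
`U_E ∩ SU_K`, complexified, lies in `𝔤_ℂ`. No genericity hypothesis: covers every member of the cell's row 13.
[cite: MoonenZarhin1998WeilClasses, §4 Remark (1)] [cite: MoonenZarhin1999LowDim, §2 (2.3)] [cite: Ribet1983, Thm. 0]
[cite: Deligne1982HodgeCycles, §4 (p. 30)] -/
theorem CMThetaCentre.centre_of_pair_kWeil [Module.Finite ℚ V] [HodgeTensorFacts.{u, u}] {ι : Type} [Fintype ι]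
    [DecidableEq ι] (hι : Fintype.card ι ≤ 3)
    (H : HodgeStructure V n) (hn : n = 1) (heff : H.IsEffective) (ψ : H.Polarization)
    {φ : Module.End ℚ V} (hφE : φ ∈ H.endAlg) {m : ℕ} (hE : ∀ a ∈ H.endAlg, ∃ q : Fin m → ℚ, a = ∑ k, q k • φ ^ (k : ℕ))
    (hEdim : Module.finrank ℚ H.endAlg = 2 * Fintype.card ι)
    (hdiv : ∀ a ∈ H.endAlg, a ≠ 0 → ∃ b : Module.End ℚ V, b * a = 1) (hφadj : ψ.adjoint φ ≠ φ)
    (μ : ι → ℂ) (hinj : Function.Injective μ) (hdist : ∀ k k', μ k' ≠ starRingEnd ℂ (μ k)) {n₀ : ℕ} (hn₀ : n₀ ≠ 0)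
    (hrank : ∀ k, Module.finrank ℂ ↥(Module.End.eigenspace (φ.baseChange ℂ) (μ k) ⊓ H.piece 1 0) +
      Module.finrank ℂ ↥(Module.End.eigenspace (φ.baseChange ℂ) (μ k) ⊓ H.piece 0 1) = n₀)
    (htop : (⨆ kt : ι × Fin 2, Module.End.eigenspace (φ.baseChange ℂ)
      (if kt.2 = 0 then μ kt.1 else starRingEnd ℂ (μ kt.1))) = ⊤)
    (𝔤 : Submodule ℚ (Module.End ℚ V))
    (hcomm : ∀ X ∈ 𝔤, ∀ a : H.endAlg, X * (a : Module.End ℚ V) = (a : Module.End ℚ V) * X)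
    (hskew : ∀ X ∈ 𝔤, ∀ v w, ψ.form (X v) w + ψ.form v (X w) = 0)
    {Θ : Module.End ℂ (ℂ ⊗[ℚ] V)} (hΘ : ∀ p, ∀ x ∈ H.piece p (n - p), Θ x = ((2 * p - n : ℤ) : ℂ) • x)
    (hΘ𝔤 : Θ ∈ spanC 𝔤)
    (hlift : ∀ k, ∀ Z : Module.End ℂ ↥(Module.End.eigenspace (φ.baseChange ℂ) (μ k)),
      LinearMap.trace ℂ _ Z = 0 → ∃ X ∈ spanC 𝔤,
        (∀ w : ↥(Module.End.eigenspace (φ.baseChange ℂ) (μ k)), X w = Z w) ∧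
        ∀ j, j ≠ k → ∀ w ∈ Module.End.eigenspace (φ.baseChange ℂ) (μ j), X w = 0)
    (k₀ k₁ k₂ : ι) (hk₁₂ : k₁ ≠ k₂) (hk₁ : k₁ ≠ k₀) (hk₂ : k₂ ≠ k₀)
    (hk₀bal : Module.finrank ℂ ↥(Module.End.eigenspace (φ.baseChange ℂ) (μ k₀) ⊓ H.piece 1 0) =
      Module.finrank ℂ ↥(Module.End.eigenspace (φ.baseChange ℂ) (μ k₀) ⊓ H.piece 0 1))
    (ht : ((Module.finrank ℂ ↥(Module.End.eigenspace (φ.baseChange ℂ) (μ k₁) ⊓ H.piece 1 0) : ℤ) -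
        Module.finrank ℂ ↥(Module.End.eigenspace (φ.baseChange ℂ) (μ k₁) ⊓ H.piece 0 1)) +
      ((Module.finrank ℂ ↥(Module.End.eigenspace (φ.baseChange ℂ) (μ k₂) ⊓ H.piece 1 0) : ℤ) -
        Module.finrank ℂ ↥(Module.End.eigenspace (φ.baseChange ℂ) (μ k₂) ⊓ H.piece 0 1)) = 0)
    (ht0 : Module.finrank ℂ ↥(Module.End.eigenspace (φ.baseChange ℂ) (μ k₂) ⊓ H.piece 1 0) ≠
      Module.finrank ℂ ↥(Module.End.eigenspace (φ.baseChange ℂ) (μ k₂) ⊓ H.piece 0 1))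
    {φK : Module.End ℚ V} (hφKE : φK ∈ H.endAlg) (hφKskew : ∀ v w, ψ.form (φK v) w + ψ.form v (φK w) = 0)
    {μK : ℂ} (hμK : μK ≠ 0)
    (hKE : ∀ k, ∀ w ∈ Module.End.eigenspace (φ.baseChange ℂ) (μ k), φK.baseChange ℂ w = μK • w)
    (c : ι → ℂ) (hc : ∑ k, c k = 0) :
    ∃ C ∈ spanC 𝔤, ∀ k, ∀ w ∈ Module.End.eigenspace (φ.baseChange ℂ) (μ k), C w = c k • w := by
  classical
  haveI : Module.Free ℚ V := Module.Free.of_divisionRing ℚ V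
  set F := φ.baseChange ℂ with hF
  set ψC := ψ.form.baseChange ℂ with hψC
  -- elements of `𝔤_ℂ`: commute with `φ_ℂ`, `ψ_ℂ`-skew, preserve the `W_{μ k}`
  have hDφ : ∀ D ∈ spanC 𝔤, D * F = F * D := fun D hD => UnitaryTheta.commute_of_mem_spanC H hφE hcomm hD
  have hDskew : ∀ D ∈ spanC 𝔤, ∀ x y, ψC (D x) y + ψC x (D y) = 0 := fun D hD =>
    ThetaSubalgebra.formBaseChange_add_eq_zero_of_mem_spanC ψ hskew hD
  have hDW : ∀ D ∈ spanC 𝔤, ∀ k, ∀ w ∈ Module.End.eigenspace F (μ k), D w ∈ Module.End.eigenspace F (μ k) :=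
    fun D hD k w hw => UnitaryTheta.apply_mem_eigenspace_of_commute (hDφ D hD) hw
  -- every place is one of `k₁, k₂, k₀`; `|ι| = 3`
  have huniv : ∀ i, i = k₁ ∨ i = k₂ ∨ i = k₀ := by
    have h3 : ({k₁, k₂, k₀} : Finset ι) = Finset.univ := by
      apply Finset.eq_of_subset_of_card_le (Finset.subset_univ _)
      rw [Finset.card_univ, Finset.card_insert_of_notMem (by simp [hk₁₂, hk₁]),
        Finset.card_insert_of_notMem (by simp [hk₂]), Finset.card_singleton]
      exact hι
    intro i
    have hi : i ∈ ({k₁, k₂, k₀} : Finset ι) := by rw [h3]; exact Finset.mem_univ _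
    simpa using hi
  have hcard3 : Fintype.card ι = 3 := by
    apply le_antisymm hι
    have h := Finset.card_le_univ ({k₁, k₂, k₀} : Finset ι)
    rwa [Finset.card_insert_of_notMem (by simp [hk₁₂, hk₁]), Finset.card_insert_of_notMem (by simp [hk₂]),
      Finset.card_singleton] at h
  -- the weights
  set t : ι → ℂ := fun k => ((Module.finrank ℂ ↥(Module.End.eigenspace F (μ k) ⊓ H.piece 1 0) : ℂ) -
    (Module.finrank ℂ ↥(Module.End.eigenspace F (μ k) ⊓ H.piece 0 1) : ℂ)) with htdef
  have ht' : t k₁ + t k₂ = 0 := by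
    have h := congrArg (fun z : ℤ => (z : ℂ)) ht
    simpa [htdef] using h
  have ht0' : t k₂ ≠ 0 := by
    simp only [htdef, sub_ne_zero, Ne, Nat.cast_inj]; exact ht0
  have ht1 : t k₁ ≠ 0 := fun h => ht0' (by rw [← ht', h, zero_add])
  have htk₀ : t k₀ = 0 := by simp only [htdef, hk₀bal, sub_self]
  -- the adapted dual basis and the coordinate traces
  obtain ⟨cb, κ, hcbW, -, -, -, hdual, hiso⟩ :=
    CMTheta.exists_adaptedDualBasis H hn heff ψ hφE hE μ hinj hdist hrank htop
  have hfin : ∀ k, Module.finrank ℂ ↥(Module.End.eigenspace F (μ k)) = n₀ := fun k => by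
    rw [hF, CMTheta.finrank_eigenspace_eq_add H hn heff hφE, hrank k]
  have he0 : ∀ k : ι, Function.Injective (fun j : Fin n₀ => (((k, (0 : Fin 2)), j) : (ι × Fin 2) × Fin n₀)) :=
    fun k j j' h => by simpa using h
  let trvL : Module.End ℂ (ℂ ⊗[ℚ] V) →ₗ[ℂ] (ι → ℂ) :=
    LinearMap.pi fun k => ∑ j : Fin n₀, (cb.coord ((k, 0), j)) ∘ₗ LinearMap.applyₗ (cb ((k, 0), j))
  have htrvL : ∀ D k, trvL D k = ∑ j, cb.repr (D (cb ((k, 0), j))) ((k, 0), j) := fun D k => by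
    simp only [trvL, LinearMap.pi_apply, LinearMap.sum_apply, LinearMap.comp_apply, LinearMap.applyₗ_apply_apply,
      Module.Basis.coord_apply]
  have htrres : ∀ D (hD : D ∈ spanC 𝔤) k, LinearMap.trace ℂ _ (D.restrict (hDW D hD k)) = trvL D k := fun D hD k => by
    rw [htrvL]; exact CMArith.trace_restrict_eq_sum_repr cb _ (he0 k) _ (hcbW k) (hfin k) D (hDW D hD k)
  -- the trace pairing with a skew Hodge endomorphism acting by scalars `σ k` on the `W_{μ k}`
  have hpair : ∀ a ∈ H.endAlg, (∀ v w, ψ.form (a v) w + ψ.form v (a w) = 0) → ∀ σ : ι → ℂ,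
      (∀ k, ∀ w ∈ Module.End.eigenspace F (μ k), a.baseChange ℂ w = σ k • w) → ∀ D ∈ spanC 𝔤,
      LinearMap.trace ℂ _ (a.baseChange ℂ * D) = 2 * ∑ k, σ k * trvL D k := fun a _ haskew σ hσ D hD => by
    simp_rw [htrvL]
    exact CMArith.trace_mul_eq_two_mul_sum cb ψC hdual hiso _ D σ (fun k j => hσ k _ (hcbW k j))
      (CMThetaCentre.baseChange_skew H ψ haskew) (hDskew D hD) (fun k j => hσ k _ (hDW D hD k _ (hcbW k j)))
  -- the coordinate traces of `Θ` are the weights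
  have htrΘ : ∀ k, trvL Θ k = t k := fun k => by
    rw [← htrres Θ hΘ𝔤 k, CMArith.trace_restrict_theta H hn heff hΘ (hDW Θ hΘ𝔤 k)]
  -- CENTRALISE: subtract the lifted traceless parts
  have hn₀C : (n₀ : ℂ) ≠ 0 := by exact_mod_cast hn₀
  have hcentral : ∀ D ∈ spanC 𝔤, ∃ C ∈ spanC 𝔤, ∀ i, ∀ w ∈ Module.End.eigenspace F (μ i),
      C w = ((n₀ : ℂ)⁻¹ * trvL D i) • w := by
    intro D hD
    have hZ : ∀ i, ∃ X ∈ spanC 𝔤, (∀ w ∈ Module.End.eigenspace F (μ i),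
        X w = D w - ((n₀ : ℂ)⁻¹ * trvL D i) • w) ∧
        ∀ j, j ≠ i → ∀ w ∈ Module.End.eigenspace F (μ j), X w = 0 := by
      intro i
      set Di := D.restrict (hDW D hD i) with hDi
      have hn₀' : (Module.finrank ℂ ↥(Module.End.eigenspace F (μ i)) : ℂ) ≠ 0 := by rw [hfin]; exact hn₀C
      obtain ⟨X, hX, hXi, hXj⟩ := hlift i _ (CMArith.trace_sub_smul_one_eq_zero hn₀' Di)
      refine ⟨X, hX, fun w hw => ?_, hXj⟩
      have h := hXi ⟨w, hw⟩
      rw [h, LinearMap.sub_apply, LinearMap.smul_apply, Module.End.one_apply, Submodule.coe_sub, Submodule.coe_smul,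
        hDi, LinearMap.coe_restrict_apply, htrres D hD i, hfin]
    choose X hX hXi hXj using hZ
    refine ⟨D - ∑ i, X i, Submodule.sub_mem _ hD (Submodule.sum_mem _ fun i _ => hX i), fun i w hw => ?_⟩
    rw [LinearMap.sub_apply, LinearMap.sum_apply, Finset.sum_eq_single i
      (fun i' _ hi' => hXj i' i (Ne.symm hi') w hw) (fun h => absurd (Finset.mem_univ i) h), hXi i w hw, sub_sub_cancel]
  -- GOAL REDUCTION: a `D ∈ 𝔤_ℂ` with coordinate traces `n₀ c`
  suffices hT : ∃ D ∈ spanC 𝔤, ∀ i, trvL D i = (n₀ : ℂ) * c i by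
    obtain ⟨D, hD, hDtr⟩ := hT
    obtain ⟨C, hC, hCw⟩ := hcentral D hD
    refine ⟨C, hC, fun i w hw => ?_⟩
    rw [hCw i w hw, hDtr i, ← mul_assoc, inv_mul_cancel₀ hn₀C, one_mul]
  -- `E` is commutative; a `ℚ`-basis `(y i)` of `E⁻` and its scalars `τ i k`
  have hEcomm : ∀ a ∈ H.endAlg, ∀ b ∈ H.endAlg, a * b = b * a := fun a ha b hb =>
    CMThetaCentre.mul_comm_of_hE H hE ha hb
  have hsE : φ - ψ.adjoint φ ∈ H.endAlg := sub_mem hφE (ψ.adjoint_mem_endAlg hφE)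
  have hs0 : φ - ψ.adjoint φ ≠ 0 := fun h => hφadj (sub_eq_zero.1 h).symm
  have hsskew : ∀ v w, ψ.form ((φ - ψ.adjoint φ) v) w + ψ.form v ((φ - ψ.adjoint φ) w) = 0 := fun v w => by
    rw [LinearMap.sub_apply, LinearMap.sub_apply, map_sub, LinearMap.sub_apply, map_sub,
      ψ.isAdjointPair_adjoint_left φ v w, ψ.form_apply_adjoint]
    ring
  obtain ⟨y, hyind, hyE, hyskew⟩ :=
    CMArith.exists_linearIndependent_skew H ψ hEcomm hdiv hEdim hsE hs0 hsskew
  choose τ hτ using fun i k => CMTheta.exists_smul_of_mem_endAlg H hE (hyE i) (μ k)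
  -- the rational trace vectors `(Tr(y_i X))_i`, `X ∈ 𝔤`
  let rL : Module.End ℚ V →ₗ[ℚ] (Fin (Fintype.card ι) → ℚ) :=
    LinearMap.pi fun i => (LinearMap.trace ℚ V) ∘ₗ LinearMap.mulLeft ℚ (y i)
  have hrL : ∀ X i, rL X i = LinearMap.trace ℚ V (y i * X) := fun X i => by
    simp only [rL, LinearMap.pi_apply, LinearMap.comp_apply, LinearMap.mulLeft_apply]
  have hrLC : ∀ X ∈ 𝔤, ∀ i, ((rL X i : ℚ) : ℂ) = 2 * ∑ k, τ i k * trvL (X.baseChange ℂ) k := fun X hX i => by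
    rw [hrL, ← hpair (y i) (hyE i) (hyskew i) (τ i) (hτ i) _ (baseChange_mem_spanC hX), ← LinearMap.baseChange_mul,
      LinearMap.trace_baseChange, eq_ratCast]
  -- the skew element attached to a rational functional `g`, and its properties
  set yv : ((Fin (Fintype.card ι) → ℚ) →ₗ[ℚ] ℚ) → Module.End ℚ V :=
    fun g => ∑ i, g (fun j => if i = j then (1 : ℚ) else 0) • y i with hyv
  have hgq : ∀ (g : (Fin (Fintype.card ι) → ℚ) →ₗ[ℚ] ℚ) x, g x = ∑ i, x i * g (fun j => if i = j then (1 : ℚ) else 0) := fun g x => by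
    rw [LinearMap.pi_apply_eq_sum_univ g x]
    simp only [smul_eq_mul]
  have hyvE : ∀ g, yv g ∈ H.endAlg := fun g => Subalgebra.sum_mem _ fun i _ => H.endAlg.smul_mem (hyE i) _
  have hyvskew : ∀ g, ∀ v w, ψ.form (yv g v) w + ψ.form v (yv g w) = 0 := fun g v w => by
    rw [hyv]
    simp only [LinearMap.sum_apply, map_sum, LinearMap.smul_apply, map_smul, smul_eq_mul, ← Finset.sum_add_distrib,
      ← mul_add, hyskew, mul_zero, Finset.sum_const_zero]
  have hyv0 : ∀ g, g ≠ 0 → yv g ≠ 0 := by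
    intro g hg0 h
    have hq0 : ∀ i, g (fun j => if i = j then (1 : ℚ) else 0) = 0 := Fintype.linearIndependent_iff.1 hyind _ (by rw [hyv] at h; exact h)
    exact hg0 (LinearMap.ext fun x => by rw [hgq, LinearMap.zero_apply]; simp [hq0])
  have hyvtr : ∀ g : (Fin (Fintype.card ι) → ℚ) →ₗ[ℚ] ℚ, (∀ X ∈ 𝔤, g (rL X) = 0) →
      ∀ X ∈ 𝔤, LinearMap.trace ℚ V (yv g * X) = 0 := fun g hg X hX => by
    have h : g (rL X) = 0 := hg X hX
    rw [hgq] at h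
    rw [← h, hyv]
    simp only [Finset.sum_mul, map_sum, smul_mul_assoc, map_smul, smul_eq_mul, hrL]
    exact Finset.sum_congr rfl fun i _ => mul_comm _ _
  -- a trace-orthogonal skew `y' ≠ 0` of `E` has `Σ σ_k t_k = 0`, hence is constant (§1)
  have hconst : ∀ y' ∈ H.endAlg, y' ≠ 0 → (∀ v w, ψ.form (y' v) w + ψ.form v (y' w) = 0) →
      (∀ X ∈ 𝔤, LinearMap.trace ℚ V (y' * X) = 0) → ∀ σ : ι → ℂ,
      (∀ k, ∀ w ∈ Module.End.eigenspace F (μ k), y'.baseChange ℂ w = σ k • w) → ∀ k, σ k = σ k₁ := by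
    intro y' hy'E hy'0 hy'skew hy'tr σ hσ
    have h2 := hpair y' hy'E hy'skew σ hσ Θ hΘ𝔤
    rw [CMThetaCentre.trace_mul_eq_zero_of_mem_spanC hy'tr hΘ𝔤] at h2
    have h3 : ∑ k, σ k * t k = 0 := by
      have := h2.symm
      rw [mul_eq_zero, or_iff_right (two_ne_zero : (2 : ℂ) ≠ 0)] at this
      rw [← this]
      exact Finset.sum_congr rfl fun k _ => by rw [htrΘ]
    exact CMThetaCentre.scalars_const_of_traceOrthogonal_kWeil hι H hn heff ψ hφE hE hdiv μ hinj hdist hn₀ hrank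
      htop k₀ k₁ k₂ hk₁₂ hk₁ hk₂ hk₀bal ht ht0 hφKE hφKskew hμK hKE hy'E hy'0 hy'skew σ hσ h3
  by_cases hQ : 𝔤.map rL = ⊤
  · /- CASE 1 (eng-5 g6's argument verbatim): the rational trace vectors span `ℚ^{|ι|}` ⟹ the matrix `(σ_k(y_i))` maps
       `trv(𝔤_ℂ)` onto `ℂ^{|ι|}`, hence is invertible, and every vector is a coordinate-trace vector -/
    let ML : (ι → ℂ) →ₗ[ℂ] (Fin (Fintype.card ι) → ℂ) :=
      LinearMap.pi fun i => ∑ k, τ i k • LinearMap.proj k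
    have hML : ∀ v i, ML v i = ∑ k, τ i k * v k := fun v i => by
      simp only [ML, LinearMap.pi_apply, LinearMap.sum_apply, LinearMap.smul_apply, LinearMap.proj_apply,
        smul_eq_mul]
    have hMLX : ∀ X ∈ 𝔤, ML (trvL (X.baseChange ℂ)) = fun i => (2 : ℂ)⁻¹ * ((rL X i : ℚ) : ℂ) := fun X hX => by
      funext i
      rw [hML, hrLC X hX i, ← mul_assoc, inv_mul_cancel₀ (two_ne_zero : (2 : ℂ) ≠ 0), one_mul]
    set R' : Submodule ℂ (Fin (Fintype.card ι) → ℂ) := (spanC 𝔤).map (ML ∘ₗ trvL) with hR'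
    have hbasis : ∀ i, (fun j => if j = i then (1 : ℂ) else 0) ∈ R' := by
      intro i
      have hv : (Pi.single i (2 : ℚ) : Fin (Fintype.card ι) → ℚ) ∈ 𝔤.map rL := by rw [hQ]; exact Submodule.mem_top
      obtain ⟨X, hX, hXv⟩ := Submodule.mem_map.1 hv
      refine Submodule.mem_map.2 ⟨X.baseChange ℂ, baseChange_mem_spanC hX, ?_⟩
      rw [LinearMap.comp_apply, hMLX X hX]
      funext j
      rw [hXv, Pi.single_apply]
      split_ifs <;> push_cast <;> ring
    have hR'top : R' = ⊤ := by
      rw [eq_top_iff]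
      intro v _
      rw [pi_eq_sum_univ v]
      refine Submodule.sum_mem _ fun i _ => Submodule.smul_mem _ _ ?_
      have h := hbasis i
      convert h using 2 with j
      simp only [eq_comm]
    have hMLsurj : Function.Surjective ML := fun v => by
      have hv : v ∈ R' := by rw [hR'top]; exact Submodule.mem_top
      obtain ⟨D, -, hDv⟩ := Submodule.mem_map.1 hv
      exact ⟨trvL D, hDv⟩
    have hMLinj : Function.Injective ML :=
      (LinearMap.injective_iff_surjective_of_finrank_eq_finrank
        (by rw [Module.finrank_fintype_fun_eq_card, Module.finrank_fintype_fun_eq_card, Fintype.card_fin])).2 hMLsurj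
    have hv : ML (fun i => (n₀ : ℂ) * c i) ∈ R' := by rw [hR'top]; exact Submodule.mem_top
    obtain ⟨D, hD, hDv⟩ := Submodule.mem_map.1 hv
    exact ⟨D, hD, fun i => congrFun (hMLinj hDv) i⟩
  · /- CASE 2: a rational functional kills the trace vectors; its skew element is constant (§1), so all coordinate-trace
       vectors have sum zero; a `D ∈ 𝔤_ℂ` with `trv_{k₀}(D) ≠ 0` exists; `Θ` and `D` span the hyperplane -/
    obtain ⟨g, hg0, hg⟩ := Submodule.exists_le_ker_of_lt_top _ (lt_top_iff_ne_top.2 hQ)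
    have hg' : ∀ X ∈ 𝔤, g (rL X) = 0 := fun X hX => hg (Submodule.mem_map_of_mem hX)
    obtain hσ₀ := fun k => CMTheta.exists_smul_of_mem_endAlg H hE (hyvE g) (μ k)
    choose σ₀ hσ₀ using hσ₀
    have hc₀ := hconst (yv g) (hyvE g) (hyv0 g hg0) (hyvskew g) (hyvtr g hg') σ₀ hσ₀
    have hσ₀0 : σ₀ k₁ ≠ 0 := by
      intro hk
      have hW : Module.End.eigenspace F (μ k₁) ≠ ⊥ := by
        intro h
        have h1 := hfin k₁
        rw [h, finrank_bot] at h1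
        exact hn₀ h1.symm
      obtain ⟨w, hw, hw0⟩ := (Submodule.ne_bot_iff _).1 hW
      exact CMArith.apply_ne_zero H hdiv (hyvE g) (hyv0 g hg0) hw0 (by rw [hσ₀ k₁ w hw, hk, zero_smul])
    -- (ii) every coordinate-trace vector has sum zero
    have hTP : ∀ D ∈ spanC 𝔤, ∑ k, trvL D k = 0 := by
      intro D hD
      have h2 := hpair (yv g) (hyvE g) (hyvskew g) σ₀ hσ₀ D hD
      rw [CMThetaCentre.trace_mul_eq_zero_of_mem_spanC (hyvtr g hg') hD,
        Finset.sum_congr rfl fun k _ => by rw [hc₀ k], ← Finset.mul_sum, ← mul_assoc] at h2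
      exact (mul_eq_zero.1 h2.symm).resolve_left (mul_ne_zero two_ne_zero hσ₀0)
    -- (iv) some `D ∈ 𝔤_ℂ` has `trv_{k₀}(D) ≠ 0`
    have hD₂ : ∃ D ∈ spanC 𝔤, trvL D k₀ ≠ 0 := by
      by_contra hall
      push Not at hall
      -- every `rL X`, `X ∈ 𝔤`, is a complex multiple of the fixed vector `v`
      set v : Fin (Fintype.card ι) → ℂ := fun i => τ i k₁ - τ i k₂ with hvdef
      have hprop : ∀ X ∈ 𝔤, ∀ i, ((rL X i : ℚ) : ℂ) = (2 * trvL (X.baseChange ℂ) k₁) * v i := by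
        intro X hX i
        have hXC := baseChange_mem_spanC (𝔤 := 𝔤) hX
        have h0 := hall _ hXC
        have hs := hTP _ hXC
        rw [Finset.sum_eq_add k₁ k₂ hk₁₂ (fun k _ hk' => by
            rcases huniv k with e | e | e
            · exact absurd e hk'.1
            · exact absurd e hk'.2
            · rw [e, h0])
          (fun h => absurd (Finset.mem_univ k₁) h) (fun h => absurd (Finset.mem_univ k₂) h)] at hs
        rw [hrLC X hX i, Finset.sum_eq_add k₁ k₂ hk₁₂ (fun k _ hk' => by
            rcases huniv k with e | e | e
            · exact absurd e hk'.1
            · exact absurd e hk'.2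
            · rw [e, h0, mul_zero])
          (fun h => absurd (Finset.mem_univ k₁) h) (fun h => absurd (Finset.mem_univ k₂) h), hvdef,
          eq_neg_of_add_eq_zero_right hs]
        ring
      -- hence `rL(𝔤)` is contained in a line
      have hline : ∃ x₀ : Fin (Fintype.card ι) → ℚ, 𝔤.map rL ≤ ℚ ∙ x₀ := by
        by_cases hex : ∃ X ∈ 𝔤, rL X ≠ 0
        · obtain ⟨X₀, hX₀, hx₀⟩ := hex
          obtain ⟨i₀, hi₀⟩ := Function.ne_iff.1 hx₀
          refine ⟨rL X₀, fun x hx => ?_⟩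
          obtain ⟨X, hX, rfl⟩ := Submodule.mem_map.1 hx
          rw [Submodule.mem_span_singleton]
          refine ⟨rL X i₀ / rL X₀ i₀, funext fun i => ?_⟩
          rw [Pi.smul_apply, smul_eq_mul]
          have hcross : ((rL X i * rL X₀ i₀ : ℚ) : ℂ) = ((rL X i₀ * rL X₀ i : ℚ) : ℂ) := by
            push_cast
            rw [hprop X hX i, hprop X₀ hX₀ i₀, hprop X hX i₀, hprop X₀ hX₀ i]
            ring
          have hcross' : rL X i * rL X₀ i₀ = rL X i₀ * rL X₀ i := by exact_mod_cast hcross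
          have hi₀' : rL X₀ i₀ ≠ 0 := by simpa using hi₀
          rw [div_mul_eq_mul_div, div_eq_iff hi₀']
          exact hcross'.symm
        · push Not at hex
          refine ⟨0, fun x hx => ?_⟩
          obtain ⟨X, hX, rfl⟩ := Submodule.mem_map.1 hx
          rw [hex X hX]
          exact Submodule.zero_mem _
      obtain ⟨x₀, hx₀⟩ := hline
      have hR1 : Module.finrank ℚ ↥(𝔤.map rL) ≤ 1 := by
        refine (Submodule.finrank_mono hx₀).trans ?_
        by_cases h0 : x₀ = 0
        · rw [h0, Submodule.span_zero_singleton, finrank_bot]; exact zero_le_one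
        · rw [finrank_span_singleton h0]
      -- two independent rational functionals kill `rL(𝔤)`
      set Ann := (𝔤.map rL).dualAnnihilator with hAnn
      have hAnn2 : 1 < Module.finrank ℚ ↥Ann := by
        have h := Subspace.finrank_add_finrank_dualAnnihilator_eq (𝔤.map rL)
        have hN : Module.finrank ℚ (Fin (Fintype.card ι) → ℚ) = Fintype.card ι := by
          rw [Module.finrank_fintype_fun_eq_card, Fintype.card_fin]
        rw [hN] at h
        have h3 : Fintype.card ι = 3 := hcard3
        change 1 < Module.finrank ℚ ↥(𝔤.map rL).dualAnnihilator
        omega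
      have hAnn0 : Ann ≠ ⊥ := by
        intro h; rw [h, finrank_bot] at hAnn2; omega
      obtain ⟨g₁, hg₁A, hg₁0⟩ := Submodule.exists_mem_ne_zero_of_ne_bot hAnn0
      obtain ⟨g₂', hg₁₂⟩ := exists_linearIndependent_pair_of_one_lt_finrank hAnn2
        (x := (⟨g₁, hg₁A⟩ : Ann)) (fun h => hg₁0 (congrArg Subtype.val h))
      set g₂ : (Fin (Fintype.card ι) → ℚ) →ₗ[ℚ] ℚ := g₂'.1 with hg₂def
      have hg₂A : g₂ ∈ Ann := g₂'.2
      have hind : ∀ r₁ r₂ : ℚ, r₁ • g₁ + r₂ • g₂ = 0 → r₁ = 0 ∧ r₂ = 0 := by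
        intro r₁ r₂ h
        refine LinearIndependent.pair_iff.1 hg₁₂ r₁ r₂ (Subtype.ext ?_)
        simpa [hg₂def] using h
      have hkill : ∀ g' ∈ Ann, ∀ X ∈ 𝔤, g' (rL X) = 0 := fun g' hg' X hX =>
        (Submodule.mem_dualAnnihilator g').1 hg' _ (Submodule.mem_map_of_mem hX)
      have hg₂0 : g₂ ≠ 0 := fun h => by
        have := (hind 0 1 (by rw [zero_smul, one_smul, zero_add, h])).2
        exact one_ne_zero this
      -- the two skew elements are both constant (§1) …
      obtain hσ₁ := fun k => CMTheta.exists_smul_of_mem_endAlg H hE (hyvE g₁) (μ k)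
      choose σ₁ hσ₁ using hσ₁
      obtain hσ₂ := fun k => CMTheta.exists_smul_of_mem_endAlg H hE (hyvE g₂) (μ k)
      choose σ₂ hσ₂ using hσ₂
      have hc₁ := hconst (yv g₁) (hyvE g₁) (hyv0 g₁ hg₁0) (hyvskew g₁) (hyvtr g₁ (hkill g₁ hg₁A)) σ₁ hσ₁
      have hc₂ := hconst (yv g₂) (hyvE g₂) (hyv0 g₂ hg₂0) (hyvskew g₂) (hyvtr g₂ (hkill g₂ hg₂A)) σ₂ hσ₂
      have hσ₁0 : σ₁ k₁ ≠ 0 := by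
        intro hk
        have hW : Module.End.eigenspace F (μ k₁) ≠ ⊥ := by
          intro h
          have h1 := hfin k₁
          rw [h, finrank_bot] at h1
          exact hn₀ h1.symm
        obtain ⟨w, hw, hw0⟩ := (Submodule.ne_bot_iff _).1 hW
        exact CMArith.apply_ne_zero H hdiv (hyvE g₁) (hyv0 g₁ hg₁0) hw0 (by rw [hσ₁ k₁ w hw, hk, zero_smul])
      -- … hence `ℂ`-proportional on `V_ℂ`: `σ₂ k₁ • (yv g₁)_ℂ = σ₁ k₁ • (yv g₂)_ℂ`
      have hyφ : ∀ g', (yv g').baseChange ℂ * F = F * (yv g').baseChange ℂ := fun g' => by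
        rw [hF, ← LinearMap.baseChange_mul, hEcomm _ (hyvE g') φ hφE, LinearMap.baseChange_mul]
      obtain ⟨cb', κ', hcbW₀, hcbW₁, -, -, hdual', hiso'⟩ :=
        CMTheta.exists_adaptedDualBasis H hn heff ψ hφE hE μ hinj hdist hrank htop
      have hfin' : ∀ k, Module.finrank ℂ ↥(Module.End.eigenspace F (starRingEnd ℂ (μ k))) = n₀ := fun k => by
        rw [← hfin k, hF, ← finrank_eigenspace_baseChange_conj_eq starRingAut φ (μ k), starRingAut_apply,
          starRingEnd_apply]
      have he1 : ∀ k : ι, Function.Injective (fun j : Fin n₀ => (((k, (1 : Fin 2)), j) : (ι × Fin 2) × Fin n₀)) :=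
        fun k j j' h => by simpa using h
      have hW'span : ∀ k, Module.End.eigenspace F (starRingEnd ℂ (μ k)) =
          Submodule.span ℂ (Set.range (cb' ∘ fun j : Fin n₀ => ((k, (1 : Fin 2)), j))) :=
        fun k => CMArith.eq_span_of_basis cb' _ (he1 k) _ (hcbW₁ k) (hfin' k)
      have hval : ∀ (g' : (Fin (Fintype.card ι) → ℚ) →ₗ[ℚ] ℚ) (σ' : ι → ℂ),
          (∀ k, ∀ w ∈ Module.End.eigenspace F (μ k), (yv g').baseChange ℂ w = σ' k • w) → (∀ k, σ' k = σ' k₁) →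
          ∀ i : (ι × Fin 2) × Fin n₀, (yv g').baseChange ℂ (cb' i) =
            (if i.1.2 = 0 then σ' k₁ else -σ' k₁) • cb' i := by
        intro g' σ' hσ' hc' i
        obtain ⟨⟨k, r⟩, j⟩ := i
        have h0 : ∀ k j, (yv g').baseChange ℂ (cb' ((k, 0), j)) = σ' k • cb' ((k, 0), j) :=
          fun k j => hσ' k _ (hcbW₀ k j)
        rcases Fin.exists_fin_two.1 ⟨r, rfl⟩ with h | h <;> rw [h]
        · rw [h0, hc' k]; simp
        · rw [CMArith.apply_eq_neg_smul_of_skew cb' (ψ.form.baseChange ℂ) hdual' hiso' _ σ' h0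
            (CMThetaCentre.baseChange_skew H ψ (hyvskew g')) (fun k j => by
              rw [← hW'span k]
              exact UnitaryTheta.apply_mem_eigenspace_of_commute (hyφ g') (hcbW₁ k j)) k j, hc' k, ← neg_smul]
          simp
      have hrel : σ₂ k₁ • (yv g₁).baseChange ℂ = σ₁ k₁ • (yv g₂).baseChange ℂ := by
        refine cb'.ext fun i => ?_
        rw [LinearMap.smul_apply, LinearMap.smul_apply, hval g₁ σ₁ hσ₁ hc₁ i, hval g₂ σ₂ hσ₂ hc₂ i, smul_smul,
          smul_smul]
        congr 1
        split_ifs <;> ring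
      -- so `yv g₁, yv g₂` are `ℚ`-dependent, contradicting the independence of `g₁, g₂`
      have hdep : ¬ LinearIndependent ℚ ![yv g₁, yv g₂] := by
        intro hli
        have hC := Fintype.linearIndependent_iff.1 (CMArith.linearIndependent_baseChange hli) ![σ₂ k₁, -σ₁ k₁]
          (by
            rw [Fin.sum_univ_two]
            simp only [Matrix.cons_val_zero, Matrix.cons_val_one]
            rw [hrel, neg_smul, add_neg_cancel])
          1
        have hC' : (![σ₂ k₁, -σ₁ k₁] : Fin 2 → ℂ) 1 = -σ₁ k₁ := rfl
        rw [hC'] at hC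
        exact hσ₁0 (neg_eq_zero.1 hC)
      obtain ⟨r, hr, i₁, hi₁⟩ := Fintype.not_linearIndependent_iff.1 hdep
      have hsum0 : ∑ i, (r 0 * g₁ (fun j => if i = j then (1 : ℚ) else 0) + r 1 * g₂ (fun j => if i = j then (1 : ℚ) else 0)) • y i = 0 := by
        rw [Fin.sum_univ_two] at hr
        simp only [Matrix.cons_val_zero, Matrix.cons_val_one] at hr
        rw [← hr, hyv]
        simp only [Finset.smul_sum, smul_smul, ← Finset.sum_add_distrib, ← add_smul]
      have hcoef : ∀ i, r 0 * g₁ (fun j => if i = j then (1 : ℚ) else 0) + r 1 * g₂ (fun j => if i = j then (1 : ℚ) else 0) = 0 :=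
        Fintype.linearIndependent_iff.1 hyind _ hsum0
      have hfun : r 0 • g₁ + r 1 • g₂ = 0 := by
        refine LinearMap.ext fun x => ?_
        rw [LinearMap.add_apply, LinearMap.smul_apply, LinearMap.smul_apply, LinearMap.zero_apply, hgq g₁ x, hgq g₂ x,
          smul_eq_mul, smul_eq_mul, Finset.mul_sum, Finset.mul_sum, ← Finset.sum_add_distrib]
        refine Finset.sum_eq_zero fun i _ => ?_
        have h := hcoef i
        linear_combination x i * h
      obtain ⟨h0, h1⟩ := hind (r 0) (r 1) hfun
      rcases Fin.exists_fin_two.1 ⟨i₁, rfl⟩ with h | h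
      · exact hi₁ (by rw [h]; exact h0)
      · exact hi₁ (by rw [h]; exact h1)
    -- (iii) `Θ` and `D₂` give the required coordinate-trace vector
    obtain ⟨D₂, hD₂, hr⟩ := hD₂
    have h3 : ({k₁, k₂, k₀} : Finset ι) = Finset.univ := by
      apply Finset.eq_of_subset_of_card_le (Finset.subset_univ _)
      rw [Finset.card_univ, Finset.card_insert_of_notMem (by simp [hk₁₂, hk₁]),
        Finset.card_insert_of_notMem (by simp [hk₂]), Finset.card_singleton]
      exact hι
    have hsplit : ∀ f : ι → ℂ, ∑ k, f k = f k₁ + f k₂ + f k₀ := fun f => by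
      rw [← h3, Finset.sum_insert (by simp [hk₁₂, hk₁]), Finset.sum_insert (by simp [hk₂]), Finset.sum_singleton,
        add_assoc]
    have hs₂ := hTP D₂ hD₂
    rw [hsplit] at hs₂
    have hc' := hc
    rw [hsplit] at hc'
    set β : ℂ := (n₀ : ℂ) * c k₀ / trvL D₂ k₀ with hβ
    set α : ℂ := ((n₀ : ℂ) * c k₁ - β * trvL D₂ k₁) / t k₁ with hα
    refine ⟨α • Θ + β • D₂, Submodule.add_mem _ (Submodule.smul_mem _ _ hΘ𝔤) (Submodule.smul_mem _ _ hD₂),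
      fun i => ?_⟩
    rw [map_add, map_smul, map_smul, Pi.add_apply, Pi.smul_apply, Pi.smul_apply, smul_eq_mul, smul_eq_mul, htrΘ]
    rcases huniv i with rfl | rfl | rfl
    · rw [hα, div_mul_cancel₀ _ ht1]; ring
    · have e1 : t i = -t k₁ := eq_neg_of_add_eq_zero_right ht'
      have e2 : trvL D₂ i = -trvL D₂ k₁ - trvL D₂ k₀ := by linear_combination hs₂
      have e3 : c i = -c k₁ - c k₀ := by linear_combination hc'
      rw [e1, e2, e3, hα, mul_neg, div_mul_cancel₀ _ ht1, hβ]
      field_simp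
      ring
    · rw [htk₀, mul_zero, zero_add, hβ, div_mul_cancel₀ _ hr]

end HodgeStructure

end Literature.AlgebraicGeometry.Motives
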